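import Summits.NavierStokesRegularity.NavierStokesRegularity.Theorems.TypeICertificateLadderTargetDepletedEnstrophySlab
import Summits.NavierStokesRegularity.NavierStokesRegularity.Theorems.TypeICertificateLadderRungReynoldsOneTaoCover
import HarnessLib

/-!
# Crux `Target` = `TypeICertificateLadder.NoTypeIBlowup` (stmt-NavierStokesRegularity-1217), line
# `depletion-ladder`, stub S2 `stub_rung_of_depletion`: a-priori power rates under rate `C` and depletion `κ`

`--supports stmt-NavierStokesRegularity-1217` (line `depletion-ladder`, stub S2).

Along a classical Leray–Hopf rapidly-decaying-datum solution `u` on `ℝ³ × [0,T)` with eventual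
dimensionless rate `√(T−t)‖u(t,x)‖ ≤ C√ν`, the depleted enstrophy slab inequality
(`DepletionLadder.lintegral_curl_sq_le_exp_depleted`, under the line's stretching-depletion hypothesis
with constant `κ`) applied on the Tao-class closed sub-slabs `[0,t]` (`RungReynoldsOne.stub_taoCover`)
gives the power rate

  `∫ ‖curl u(t)‖² ≤ K (T−t)^{−κ²C²/2}`  on `(0,T)`

(`lintegral_curl_sq_le_rpow_of_rate`): with `B₀` bounding `u` before the rate sets in,
`‖u(s)‖²_∞ ≤ B₀² + C²ν/(T−s)`, so `∫₀ᵗ‖u‖²_∞ ≤ B₀²T + C²ν log(T/(T−t))` and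
`exp((κ²/(2ν))∫₀ᵗ‖u‖²_∞) ≤ e^{κ²B₀²T/(2ν)} (T/(T−t))^{κ²C²/2}` — the bookkeeping of
`RungReynoldsOne.aprioriDecay_of` with `(2ν)⁻¹ ↦ κ²/(2ν)` and `ν ↦ C²ν`. Together with the energy
bound (`IsLerayHopfOn.lintegral_enorm_sq_le`) and `∫|∇u|² ≤ ∫|curl u|²`
(`lintegral_frobeniusNormSq_fderiv_le_lintegral_sq_norm_curl`) this is the `H¹`-type rate
`‖u(t)‖₂² + ‖∇u(t)‖₂² ≤ K′(T−t)^{−κ²C²/2}` (`energy_add_enstrophy_le_rpow_of_rate`) consumed by the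
closing step of S2. [folklore: Grönwall bookkeeping]
-/

noncomputable section

open Set Filter Topology MeasureTheory
open scoped RealInnerProductSpace ENNReal NNReal Laplacian ContDiff
open Literature.Analysis.FluidPDE

namespace Summit.NavierStokesRegularity.NavierStokesRegularity.Theorems.DepletionLadder

-- the problem directory repeats the summit name (`NavierStokesRegularity/NavierStokesRegularity`)
set_option linter.dupNamespace false

open Summit.NavierStokesRegularity.NavierStokesRegularity.Theorems.RungReynoldsOne

/-- The rate squared: `√(T−t)‖y‖ ≤ C√ν` with `t < T` gives `‖y‖² ≤ C²ν/(T−t)`. [folklore] -/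
theorem sq_norm_le_of_rate_mul {ν T t C : ℝ} (hν : 0 ≤ ν) (htT : t < T)
    {y : EuclideanSpace ℝ (Fin 3)} (h : Real.sqrt (T - t) * ‖y‖ ≤ C * Real.sqrt ν) :
    ‖y‖ ^ 2 ≤ C ^ 2 * ν / (T - t) := by
  have hTt : 0 < T - t := sub_pos.2 htT
  have h0 : 0 ≤ Real.sqrt (T - t) * ‖y‖ := by positivity
  have h2 : (Real.sqrt (T - t) * ‖y‖) ^ 2 ≤ (C * Real.sqrt ν) ^ 2 := pow_le_pow_left₀ h0 h 2
  rw [mul_pow, mul_pow, Real.sq_sqrt hTt.le, Real.sq_sqrt hν] at h2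
  rw [le_div_iff₀ hTt]
  linarith

/-- **A-priori power rate of the enstrophy under rate `C` and depletion `κ`.** Assume the
stretching-depletion hypothesis with constant `κ` (body of `DepletionLadder.StretchingDepletion κ`).
Every classical solution on `ℝ³ × [0,T)`, Leray–Hopf from its rapidly decaying datum, with eventual
rate `√(T−t)‖u(t,x)‖ ≤ C√ν`, satisfies `∫ ‖curl u(t)‖² ≤ K (T−t)^{−κ²C²/2}` for some `K ≥ 0`
and all `t ∈ (0,T)`. [folklore] -/
theorem lintegral_curl_sq_le_rpow_of_rate {ν κ T C : ℝ} (hν : 0 < ν) (hT : 0 < T)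
    (hdep : ∀ (u : EuclideanSpace ℝ (Fin 3) → EuclideanSpace ℝ (Fin 3)) (M : ℝ), ContDiff ℝ 2 u →
      VectorCalculus.IsDivFree u → (∀ x, ‖u x‖ ≤ M) →
      Integrable (fun x => ‖curl u x‖ ^ 2) →
      Integrable (fun x => frobeniusNormSq (fderiv ℝ (curl u) x)) →
      Integrable (fun x => ⟪curl u x, fderiv ℝ u x (curl u x)⟫) →
      |∫ x, ⟪curl u x, fderiv ℝ u x (curl u x)⟫| ≤
        κ * M * Real.sqrt (∫ x, ‖curl u x‖ ^ 2) *
          Real.sqrt (∫ x, frobeniusNormSq (fderiv ℝ (curl u) x)))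
    {u : ℝ → EuclideanSpace ℝ (Fin 3) → EuclideanSpace ℝ (Fin 3)}
    {p : ℝ → EuclideanSpace ℝ (Fin 3) → ℝ}
    (hsol : IsClassicalNSSolutionOn (Ico 0 T) ν 0 u p) (hLH : IsLerayHopfOn T ν 0 (u 0) u)
    (hdec : HasRapidSpatialDecay (u 0))
    (hrate : ∀ᶠ t in 𝓝[<] T, ∀ x, Real.sqrt (T - t) * ‖u t x‖ ≤ C * Real.sqrt ν) :
    ∃ K : ℝ, 0 ≤ K ∧ ∀ t ∈ Ioo 0 T,
      ∫⁻ x, ‖curl (u t) x‖ₑ ^ 2 ≤ ENNReal.ofReal (K * (T - t) ^ (-(κ ^ 2 * C ^ 2 / 2))) := by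
  -- the onset `t₀ ∈ (0, T)` of the rate
  obtain ⟨a, haT, hsub⟩ := mem_nhdsLT_iff_exists_Ioo_subset.1 hrate
  set t₀ : ℝ := (max a (T / 2) + T) / 2 with ht₀def
  have hmax : max a (T / 2) < T := max_lt haT (by linarith)
  have hat₀ : a < t₀ := by
    have := le_max_left a (T / 2); rw [ht₀def]; linarith
  have ht₀ : t₀ ∈ Ioo 0 T := by
    have := le_max_right a (T / 2); rw [ht₀def]; constructor <;> linarith
  have hrate' : ∀ s ∈ Ico t₀ T, ∀ x, Real.sqrt (T - s) * ‖u s x‖ ≤ C * Real.sqrt ν :=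
    fun s hs => hsub ⟨hat₀.trans_le hs.1, hs.2⟩
  -- a sup bound on `[0, t₀]` from the Tao cover at `T' = t₀`
  obtain ⟨q₀, hsol₀, hu₀, -, -⟩ := stub_taoCover hν hT hsol hLH hdec ht₀
  obtain ⟨B₀, hB₀0, hB₀⟩ := exists_forall_norm_le_of_hasBoundedSobolevNormsOn hsol₀ hu₀
  obtain ⟨C₁, hC₁⟩ := hu₀ 1
  -- the sup-norm bound `‖u(s)‖²_∞ ≤ B₀² + C²ν/(T−s)` on `[0, T)`
  have hNsq : ∀ s ∈ Ico 0 T, (eLpNorm (u s) ⊤ volume).toReal ^ (2 : ℝ) ≤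
      B₀ ^ 2 + C ^ 2 * ν / (T - s) := by
    intro s hs
    have hTs : 0 < T - s := sub_pos.2 hs.2
    rw [Real.rpow_two]
    by_cases hst : s < t₀
    · have h1 : (eLpNorm (u s) ⊤ volume).toReal ≤ B₀ :=
        toReal_eLpNorm_top_le_of_bound hB₀0 (hB₀ s ⟨hs.1, hst.le⟩)
      have h2 : 0 ≤ C ^ 2 * ν / (T - s) := by positivity
      nlinarith [ENNReal.toReal_nonneg (a := eLpNorm (u s) ⊤ volume)]
    · have hb : 0 ≤ Real.sqrt (C ^ 2 * ν / (T - s)) := Real.sqrt_nonneg _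
      have h1 : ∀ x, ‖u s x‖ ≤ Real.sqrt (C ^ 2 * ν / (T - s)) := fun x =>
        Real.le_sqrt_of_sq_le
          (sq_norm_le_of_rate_mul hν.le hs.2 (hrate' s ⟨not_lt.1 hst, hs.2⟩ x))
      have h2 : (eLpNorm (u s) ⊤ volume).toReal ≤ Real.sqrt (C ^ 2 * ν / (T - s)) :=
        toReal_eLpNorm_top_le_of_bound hb h1
      have h3 := pow_le_pow_left₀ ENNReal.toReal_nonneg h2 2
      rw [Real.sq_sqrt (by positivity)] at h3
      nlinarith [sq_nonneg B₀]
  -- the integrated sup-norm bound `Λ(t) ≤ B₀²T + C²ν log(T/(T−t))`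
  have hΛ : ∀ t ∈ Ioo 0 T,
      ∫⁻ s in Ioo 0 t, ENNReal.ofReal ((eLpNorm (u s) ⊤ volume).toReal ^ (2 : ℝ)) ≤
        ENNReal.ofReal (B₀ ^ 2 * T + C ^ 2 * ν * Real.log (T / (T - t))) := by
    intro t ht
    have hTt : 0 < T - t := sub_pos.2 ht.2
    have hlog : 0 ≤ Real.log (T / (T - t)) :=
      Real.log_nonneg ((one_le_div hTt).2 (by linarith [ht.1]))
    have hC2 : 0 ≤ C ^ 2 * ν := by positivity
    calc ∫⁻ s in Ioo 0 t, ENNReal.ofReal ((eLpNorm (u s) ⊤ volume).toReal ^ (2 : ℝ))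
        ≤ ∫⁻ s in Ioo 0 t, (ENNReal.ofReal (B₀ ^ 2) + ENNReal.ofReal (C ^ 2 * ν / (T - s))) := by
          refine setLIntegral_mono' measurableSet_Ioo fun s hs => ?_
          rw [← ENNReal.ofReal_add (sq_nonneg _) (div_nonneg hC2 (by linarith [hs.2, ht.2]))]
          exact ENNReal.ofReal_le_ofReal (hNsq s ⟨hs.1.le, hs.2.trans ht.2⟩)
      _ = ENNReal.ofReal (B₀ ^ 2) * volume (Ioo 0 t) +
            ∫⁻ s in Ioo 0 t, ENNReal.ofReal (C ^ 2 * ν / (T - s)) := by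
          rw [lintegral_add_left measurable_const, setLIntegral_const]
      _ = ENNReal.ofReal (B₀ ^ 2 * t) + ENNReal.ofReal (C ^ 2 * ν * Real.log (T / (T - t))) := by
          rw [lintegral_Ioo_div_sub_eq hC2 ht.1.le ht.2, Real.volume_Ioo, sub_zero,
            ← ENNReal.ofReal_mul (sq_nonneg _)]
      _ = ENNReal.ofReal (B₀ ^ 2 * t + C ^ 2 * ν * Real.log (T / (T - t))) :=
          (ENNReal.ofReal_add (mul_nonneg (sq_nonneg _) ht.1.le) (mul_nonneg hC2 hlog)).symm
      _ ≤ ENNReal.ofReal (B₀ ^ 2 * T + C ^ 2 * ν * Real.log (T / (T - t))) := by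
          refine ENNReal.ofReal_le_ofReal ?_
          nlinarith [sq_nonneg B₀, ht.2]
  -- finiteness of the enstrophy at time `0`
  have h00 : (0 : ℝ) ∈ Icc 0 t₀ := ⟨le_rfl, ht₀.1.le⟩
  have hZ0 : ∫⁻ x, ‖curl (u 0) x‖ₑ ^ 2 ≤ 6 * C₁ := by
    calc ∫⁻ x, ‖curl (u 0) x‖ₑ ^ 2 ≤ ∫⁻ x, 6 * ‖iteratedFDeriv ℝ 1 (u 0) x‖ₑ ^ 2 :=
          lintegral_mono fun x => enorm_curl_sq_le_six_mul (u 0) x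
      _ = 6 * ∫⁻ x, ‖iteratedFDeriv ℝ 1 (u 0) x‖ₑ ^ 2 := lintegral_const_mul' _ _ (by norm_num)
      _ ≤ 6 * C₁ := by gcongr; exact hC₁ 0 h00
  have hZ0top : ∫⁻ x, ‖curl (u 0) x‖ₑ ^ 2 ≠ ⊤ :=
    (hZ0.trans_lt (ENNReal.mul_lt_top (by norm_num) ENNReal.coe_lt_top)).ne
  set Z0 : ℝ := (∫⁻ x, ‖curl (u 0) x‖ₑ ^ 2).toReal with hZ0def
  have hZ0nn : 0 ≤ Z0 := ENNReal.toReal_nonneg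
  -- the constant
  set kν : ℝ := κ ^ 2 / (2 * ν) with hkν
  have hk0 : 0 ≤ kν := by positivity
  set γ : ℝ := κ ^ 2 * C ^ 2 / 2 with hγ
  have hγk : kν * (C ^ 2 * ν) = γ := by
    rw [hkν, hγ]
    field_simp
  set K : ℝ := Real.exp (kν * (B₀ ^ 2 * T)) * T ^ γ * Z0 with hK
  refine ⟨K, by positivity, fun t ht => ?_⟩
  obtain ⟨q, hsolt, hut, hutt, -⟩ := stub_taoCover hν hT hsol hLH hdec ht
  have hTt : 0 < T - t := sub_pos.2 ht.2
  have hΛt := hΛ t ht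
  have hΛtop : ∫⁻ s in Ioo 0 t, ENNReal.ofReal ((eLpNorm (u s) ⊤ volume).toReal ^ (2 : ℝ)) ≠ ⊤ :=
    (hΛt.trans_lt ENNReal.ofReal_lt_top).ne
  have hmain := lintegral_curl_sq_le_exp_depleted hν ht.1 hdep hsolt hut hutt ⟨ht.1, le_rfl⟩ hΛtop
  refine hmain.trans ?_
  have hlog : 0 ≤ Real.log (T / (T - t)) :=
    Real.log_nonneg ((one_le_div hTt).2 (by linarith [ht.1]))
  have hrhs0 : 0 ≤ B₀ ^ 2 * T + C ^ 2 * ν * Real.log (T / (T - t)) := by positivity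
  have hexp : Real.exp (κ ^ 2 / (2 * ν) *
      (∫⁻ s in Ioo 0 t, ENNReal.ofReal ((eLpNorm (u s) ⊤ volume).toReal ^ (2 : ℝ))).toReal) ≤
      Real.exp (kν * (B₀ ^ 2 * T)) * (T / (T - t)) ^ γ := by
    have h1 : (∫⁻ s in Ioo 0 t, ENNReal.ofReal ((eLpNorm (u s) ⊤ volume).toReal ^ (2 : ℝ))).toReal ≤
        B₀ ^ 2 * T + C ^ 2 * ν * Real.log (T / (T - t)) := ENNReal.toReal_le_of_le_ofReal hrhs0 hΛt
    have h2 := Real.exp_le_exp.2 (mul_le_mul_of_nonneg_left h1 hk0)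
    refine h2.trans_eq ?_
    rw [exp_mul_add_mul_log (div_pos hT hTt), hγk]
  have hpow : (T / (T - t)) ^ γ = T ^ γ * (T - t) ^ (-γ) := by
    rw [Real.div_rpow hT.le hTt.le, Real.rpow_neg hTt.le, div_eq_mul_inv]
  calc ENNReal.ofReal (Real.exp (κ ^ 2 / (2 * ν) *
        (∫⁻ s in Ioo 0 t, ENNReal.ofReal ((eLpNorm (u s) ⊤ volume).toReal ^ (2 : ℝ))).toReal)) *
        ∫⁻ x, ‖curl (u 0) x‖ₑ ^ 2
      ≤ ENNReal.ofReal (Real.exp (kν * (B₀ ^ 2 * T)) * (T / (T - t)) ^ γ) * ENNReal.ofReal Z0 := by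
        rw [ENNReal.ofReal_toReal hZ0top]
        gcongr
    _ = ENNReal.ofReal (K * (T - t) ^ (-γ)) := by
        rw [← ENNReal.ofReal_mul (by positivity), hpow, hK]
        ring_nf

/-- **The `H¹`-type power rate under rate `C` and depletion `κ`** (the form consumed by the closing
step of S2): under the stretching-depletion hypothesis with constant `κ`, along every classical
Leray–Hopf rapidly-decaying-datum solution on `[0,T)` with eventual rate `√(T−t)‖u(t,x)‖ ≤ C√ν`,
`‖u(t)‖₂² + ‖∇u(t)‖₂² ≤ K′(T−t)^{−κ²C²/2}` for all `t ∈ [T/2, T)`: energy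
`≤ 2E(u₀)` (`IsLerayHopfOn.lintegral_enorm_sq_le`), `∫|∇u|² ≤ ∫|curl u|²`
(`lintegral_frobeniusNormSq_fderiv_le_lintegral_sq_norm_curl`) and
`lintegral_curl_sq_le_rpow_of_rate`. [folklore] -/
theorem energy_add_enstrophy_le_rpow_of_rate {ν κ T C : ℝ} (hν : 0 < ν) (hT : 0 < T)
    (hdep : ∀ (u : EuclideanSpace ℝ (Fin 3) → EuclideanSpace ℝ (Fin 3)) (M : ℝ), ContDiff ℝ 2 u →
      VectorCalculus.IsDivFree u → (∀ x, ‖u x‖ ≤ M) →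
      Integrable (fun x => ‖curl u x‖ ^ 2) →
      Integrable (fun x => frobeniusNormSq (fderiv ℝ (curl u) x)) →
      Integrable (fun x => ⟪curl u x, fderiv ℝ u x (curl u x)⟫) →
      |∫ x, ⟪curl u x, fderiv ℝ u x (curl u x)⟫| ≤
        κ * M * Real.sqrt (∫ x, ‖curl u x‖ ^ 2) *
          Real.sqrt (∫ x, frobeniusNormSq (fderiv ℝ (curl u) x)))
    {u : ℝ → EuclideanSpace ℝ (Fin 3) → EuclideanSpace ℝ (Fin 3)}
    {p : ℝ → EuclideanSpace ℝ (Fin 3) → ℝ}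
    (hsol : IsClassicalNSSolutionOn (Ico 0 T) ν 0 u p) (hLH : IsLerayHopfOn T ν 0 (u 0) u)
    (hdec : HasRapidSpatialDecay (u 0))
    (hrate : ∀ᶠ t in 𝓝[<] T, ∀ x, Real.sqrt (T - t) * ‖u t x‖ ≤ C * Real.sqrt ν) :
    ∃ K : ℝ, ∃ t₀ ∈ Ico 0 T, ∀ t ∈ Ico t₀ T,
      (∫⁻ x, ‖u t x‖ₑ ^ 2) + ∫⁻ x, ENNReal.ofReal (frobeniusNormSq (fderiv ℝ (u t) x)) ≤
        ENNReal.ofReal (K * (T - t) ^ (-(κ ^ 2 * C ^ 2 / 2))) := by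
  obtain ⟨K, hK0, hK⟩ := lintegral_curl_sq_le_rpow_of_rate hν hT hdep hsol hLH hdec hrate
  set γ : ℝ := κ ^ 2 * C ^ 2 / 2 with hγ
  have hγ0 : 0 ≤ γ := by positivity
  set E₀ : ℝ := 2 * VectorCalculus.kineticEnergy (u 0) with hE₀
  -- the energy bound, made nonnegative
  have hE : ∀ t ∈ Icc 0 T, ∫⁻ x, ‖u t x‖ₑ ^ 2 ≤ ENNReal.ofReal (max E₀ 0) := fun t ht =>
    (hLH.lintegral_enorm_sq_le hν.le ht).trans (ENNReal.ofReal_le_ofReal (le_max_left _ _))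
  refine ⟨max E₀ 0 * T ^ γ + K, T / 2, ⟨by positivity, by linarith⟩, fun t ht => ?_⟩
  have ht' : t ∈ Ioo 0 T := ⟨lt_of_lt_of_le (by positivity) ht.1, ht.2⟩
  have htc : t ∈ Icc 0 T := ⟨ht'.1.le, ht'.2.le⟩
  have htI : t ∈ Ico 0 T := ⟨ht'.1.le, ht'.2⟩
  have hTt : 0 < T - t := sub_pos.2 ht.2
  -- `∫|∇u(t)|² ≤ ∫|curl u(t)|²`
  have hL2 : ∫⁻ x, ‖u t x‖ₑ ^ 2 < ⊤ := (hE t htc).trans_lt ENNReal.ofReal_lt_top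
  have hG : ∫⁻ x, ENNReal.ofReal (frobeniusNormSq (fderiv ℝ (u t) x)) ≤ ∫⁻ x, ‖curl (u t) x‖ₑ ^ 2 :=
    lintegral_frobeniusNormSq_fderiv_le_lintegral_sq_norm_curl
      ((hsol.contDiff_velocity htI).of_le (by norm_cast)) (hsol.divFree t htI) hL2
  -- `max E₀ 0 ≤ max E₀ 0 · T^γ (T−t)^{−γ}`
  have hone : 1 ≤ T ^ γ * (T - t) ^ (-γ) := by
    rw [Real.rpow_neg hTt.le, ← div_eq_mul_inv, ← Real.div_rpow hT.le hTt.le]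
    exact Real.one_le_rpow ((one_le_div hTt).2 (by linarith [ht'.1])) hγ0
  have hE' : max E₀ 0 ≤ max E₀ 0 * T ^ γ * (T - t) ^ (-γ) := by
    have := mul_le_mul_of_nonneg_left hone (le_max_right E₀ 0)
    rw [mul_one] at this
    simpa [mul_assoc] using this
  calc (∫⁻ x, ‖u t x‖ₑ ^ 2) + ∫⁻ x, ENNReal.ofReal (frobeniusNormSq (fderiv ℝ (u t) x))
      ≤ ENNReal.ofReal (max E₀ 0) + ENNReal.ofReal (K * (T - t) ^ (-γ)) :=
        add_le_add (hE t htc) (hG.trans (hK t ht'))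
    _ = ENNReal.ofReal (max E₀ 0 + K * (T - t) ^ (-γ)) :=
        (ENNReal.ofReal_add (le_max_right _ _) (by positivity)).symm
    _ ≤ ENNReal.ofReal ((max E₀ 0 * T ^ γ + K) * (T - t) ^ (-γ)) := by
        refine ENNReal.ofReal_le_ofReal ?_
        rw [add_mul]
        exact add_le_add hE' le_rfl

end Summit.NavierStokesRegularity.NavierStokesRegularity.Theorems.DepletionLadder

end
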